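import Summits.BirchSwinnertonDyer.BirchSwinnertonDyer.Theorems.ByReductionTypeAtTwoAdditiveInertTwistSupply
import HarnessLib

/-!
# Route `ByReductionTypeAtTwo` (rung K4), crux `AdditiveRankZeroAtTwo` (item
# stmt-BirchSwinnertonDyer-19098), DEFECT-`≥ 3` sub-class: the inert pair door on the CANONICAL
# model and its EXACTNESS CERTIFICATE — the wall `stub_addDefectThree` is EQUIVALENT, modulo PRINT,
# to two ∀-objects: the upper half at the additive prime (`hU`) and the `2`-part over an inert
# quadratic field on `W.baseChange K` (`hKC`) (seat `bsd-2adic-addL2x`, GEN 0)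

HONEST FRAMING (cell `bsd-2adic`, run/shared/lean/pub/bsd-2adic/, HUMAN RULINGS D-0036/D-0074):
theorems only; NO new definition; the displayed PRINT inputs are Gross–Zagier–Kolyvagin (`hGZK`),
modularity (`hmod`), Milne 1972 Thm. 1 in Dokchitser–Dokchitser's any-model currency (`hMilneC`,
`Milne1972.bsdQuotient_baseChange_quadratic_anyModel`) and Murty–Murty 1997 Ch. 6 Thm. 1.2 (`hMM`,
`murtyMurty_exists_twist_ne_zero_prescribedAtTwo`, p528043); nothing else asserted; no class closed;
BSD is not proved by any of this. PARTITION (D-0054): X5@2 ADDITIVE, defect-`≥ 3` sub-class (B1·O1;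
1 382 of the 1 945 book230 classes: `C₃` 454 + `C₆` 147 + `C₄` 18 + `Q₈` 189 + `SL₂(𝔽₃)` 574) × p = 2
— types-the-object-of; closes none.

WHAT THIS FILE ADDS to `Theorems.additiveDefectAtTwo_of_inertPair` (lane A, p422893; twist supply fed
in `…AdditiveInertTwistSupply.lean`, p528770). (1) The pair theorem and the door are restated on the
CANONICAL model `W.baseChange K` (`AdditivePotMult.MissingPPartOverCAt`, Dokchitser–Dokchitser's
`C(E/K)`; no globally minimal `K`-model, no class-group condition), exactly as lane A's GEN 4 did for
the quadratic sub-class (`Theorems.forall_overKC_iff_additiveQuadraticAtTwo`). (2) The upper-half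
input is needed ONLY on the defect-`≥ 3` sub-class itself (`hU3`), because an unramified quadratic
twist preserves the sub-class (`defectAtLeastThree_of_smul_quadraticTwist_of_emod_four_eq_one`: it
preserves additivity — lane A — and quadratic semistabilisability — §2 here). (3) EXACTNESS: modulo
the four PRINT facts, BSD₂ ∀-closed on the defect-`≥ 3` sub-class is EQUIVALENT to `hU3 ∧ hKC`
(`additiveDefectAtTwo_iff_upper_and_overKC_of_murtyMurty`), and the crux `AdditiveRankZeroAtTwo` is
EQUIVALENT to (its quadratic part) `∧ hU3 ∧ hKC`
(`additiveRankZeroAtTwo_iff_quadratic_and_upper_and_overKC_of_murtyMurty`). Reading for the planner: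
the registered wall stub `stub_addDefectThree` of line `add_twist_overK` can be RESHAPED without loss
into two stubs of known joint strength — `hU3` (lens L1: Kato 14.5 (3) / 13.4 (3) print «p ≠ 2») and
`hKC` (the `Δ = C₃`-equivariant-descent / base-change object over an inert quadratic field; no print
at `p = 2`; WALL on the 2-power core) — both genuinely weaker than the crux separately, jointly equal.

## Contents
* §1 `missingPPartAt_pair_of_overC_of_upper_upper` — the pair theorem of MEMO-1 (§2b of
  `X5/TwoAdicAdditiveL2.lean`) on an ARBITRARY `K`-model `V` (identity (★)
  `AdditivePotMult.shaAnOverC_mul_eq`), any prime; `bsdp_two_pair_of_overKC_of_upper_upper` — at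
  `p = 2` on `W.baseChange K` with Milne any-model discharging the Weil-restriction identity.
* §2 `quadSemistabilisable_of_smul_quadraticTwist`, `defectAtLeastThree_of_smul_quadraticTwist_of_emod_four_eq_one`.
* §3 `additiveDefectAtTwo_of_upper_of_overKC_of_murtyMurty` — the canonical inert door.
* §4 the two exactness certificates, and the crux BY NAME from (quadratic part, `hU3`, `hKC`) + PRINT.

References: [Milne1972ArithmeticAV] §1 Thm. 1 (through [DokchitserDokchitserAnnals2010] §2.1);
[MurtyMurty1997] Ch. 6 Thms. 1.1–1.2; [SilvermanAEC2009] X.5 Cor. 5.4.1 (twists and isomorphisms).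
-/

set_option autoImplicit false
-- the Theorems namespace of this sub repeats the summit name by design (D-0017 nested layout)
set_option linter.dupNamespace false

noncomputable section

open scoped Classical

open WeierstrassCurve Literature.NumberTheory.EllipticCurves
  Literature.NumberTheory.EllipticCurves.Rank1Residual
  Literature.NumberTheory.EllipticCurves.Rank1Residual.Typed
  Literature.NumberTheory.QuadraticFields
  Summit.BirchSwinnertonDyer.Rank1Residual.AdditivePotMult
  Summit.BirchSwinnertonDyer.Rank1Residual.X5.AddTwoL2
  Summit.BirchSwinnertonDyer.BirchSwinnertonDyer.Theses.ByReductionTypeAtTwo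

namespace Summit.BirchSwinnertonDyer.BirchSwinnertonDyer.Theorems

/-! ## §1. The pair theorem on an arbitrary `K`-model, and on the canonical model at `p = 2` -/

section Pair

variable (W : WeierstrassCurve ℚ) [W.IsElliptic] (p : ℕ) [Fact p.Prime]
  (K : Type) [Field K] [NumberField K]
  (Wd : WeierstrassCurve ℚ) [Wd.IsElliptic] (V : WeierstrassCurve K) [V.IsElliptic]

/-- **Pair theorem on an arbitrary `K`-model (any prime `p`, any quadratic `K`).** Under the
hypotheses of (★) `AdditivePotMult.shaAnOverC_mul_eq` (modularity, `[K:ℚ] = 2`, `Wd` a model of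
`W^{(d_K)}`, `V` any `K`-model of `W_K`, the three `Ш` finite, the model-free Weil-restriction identity
`hWR` with Dokchitser–Dokchitser's `C(V)`): if the `p`-part of BSD holds for `V` over `K`
(`MissingPPartOverCAt V p`) and the UPPER halves `ord_p #Ш ≤ ord_p #Ш_an` hold for `W` and `Wd` over
`ℚ`, then the `p`-part holds for BOTH `W` and `Wd`: (★) reads `q'·#Ш(W)·#Ш(Wd) = q·q_d·#Ш(V)`, so the
defects `def(X) = ord_p #Ш_an(X) − ord_p #Ш(X)` satisfy `def(V) = def(W) + def(Wd)`, and `def(V) = 0`,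
`def(W), def(Wd) ≥ 0` force both to vanish. No parity hypothesis. The model-free twin of
`AddTwoL2.missingPPartAt_pair_of_over_of_upper_upper` (same algebra).
[cite: Milne1972ArithmeticAV, §1 Thm. 1 (through DokchitserDokchitserAnnals2010 §2.1)] -/
theorem missingPPartAt_pair_of_overC_of_upper_upper (hmod : hasEntireLFunction_rat)
    (h2 : Module.finrank ℚ K = 2)
    (hWd : ∃ C : VariableChange ℚ, C • W.quadraticTwist (NumberField.discr K : ℚ) = Wd)
    (hV : ∃ C : VariableChange K, C • W.baseChange K = V)
    (hshaW : W.ShaFinite) (hshaD : Wd.ShaFinite) (hshaK : V.ShaFinite)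
    (hWR : (V.shaOrder : ℝ) * V.regulator * V.bsdPeriod * (V.modifiedTamagawaProduct : ℝ) /
        (V.torsionOrder : ℝ) ^ 2 = W.bsdRHS * Wd.bsdRHS)
    (hK : MissingPPartOverCAt V p) (hu : MissingUpperBoundAt W p)
    (hud : MissingUpperBoundAt Wd p) : MissingPPartAt W p ∧ MissingPPartAt Wd p := by
  obtain ⟨q', hq', hv'⟩ := hK
  obtain ⟨q, hq, hle⟩ := hu
  obtain ⟨qd, hqd, hled⟩ := hud
  have hstar := shaAnOverC_mul_eq W K Wd V hmod h2 hWd hV hshaW hshaD hWR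
  have hsW : W.shaOrder ≠ 0 := (W.shaOrder_pos hshaW).ne'
  have hsD : Wd.shaOrder ≠ 0 := (Wd.shaOrder_pos hshaD).ne'
  have hsK : V.shaOrder ≠ 0 := (V.shaOrder_pos hshaK).ne'
  have hq0 : q ≠ 0 := by
    intro h0; apply shaAn_ne_zero W hmod; rw [hq, h0, Rat.cast_zero]
  have hqd0 : qd ≠ 0 := by
    intro h0; apply shaAn_ne_zero Wd hmod; rw [hqd, h0, Rat.cast_zero]
  -- (★) in `ℚ`
  have hQ : q' * W.shaOrder * Wd.shaOrder = q * qd * V.shaOrder := by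
    have h : ((q' * W.shaOrder * Wd.shaOrder : ℚ) : ℂ) = ((q * qd * V.shaOrder : ℚ) : ℂ) := by
      push_cast
      rw [← hq, ← hq', ← hqd]
      exact hstar
    exact_mod_cast h
  have hsWq : (W.shaOrder : ℚ) ≠ 0 := by exact_mod_cast hsW
  have hsDq : (Wd.shaOrder : ℚ) ≠ 0 := by exact_mod_cast hsD
  have hsKq : (V.shaOrder : ℚ) ≠ 0 := by exact_mod_cast hsK
  have hq'0 : q' ≠ 0 := by
    intro h0
    rw [h0, zero_mul, zero_mul] at hQ
    exact mul_ne_zero (mul_ne_zero hq0 hqd0) hsKq hQ.symm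
  have hv := congrArg (padicValRat p) hQ
  rw [padicValRat.mul (mul_ne_zero hq'0 hsWq) hsDq, padicValRat.mul hq'0 hsWq,
    padicValRat.mul (mul_ne_zero hq0 hqd0) hsKq, padicValRat.mul hq0 hqd0,
    padicValRat.of_nat, padicValRat.of_nat, padicValRat.of_nat] at hv
  refine ⟨⟨q, hq, ?_⟩, ⟨qd, hqd, ?_⟩⟩
  · push_cast at hv hle hled hv' ⊢; linarith
  · push_cast at hv hle hled hv' ⊢; linarith

/-- **`p = 2` on the canonical model, Milne and GZK discharged: `BSD(W,2) ∧ BSD(Wd,2)` from the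
`2`-part over `K` on `W.baseChange K` and the two upper halves.** For `W/ℚ`, `Wd` globally minimal of
analytic rank `≤ 1`, `K` any quadratic field: `MissingPPartOverCAt (W.baseChange K) 2 ∧
MissingUpperBoundAt W 2 ∧ MissingUpperBoundAt Wd 2 ⟹ BSDp W 2 ∧ BSDp Wd 2` (the Weil-restriction
identity and the finiteness of `Ш(E_K)` from `hMilneC`, finiteness over `ℚ` from `hGZK`). The
canonical-model twin of `AddTwoL2.bsdp_two_pair_of_overK_of_upper_upper`: no `K`-model is chosen.
[cite: Milne1972ArithmeticAV, §1 Thm. 1 (through DokchitserDokchitserAnnals2010 §2.1)] -/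
theorem bsdp_two_pair_of_overKC_of_upper_upper [W.IsGloballyMinimal] [Wd.IsGloballyMinimal]
    (hGZK : rank_eq_analyticRank_of_analyticRank_le_one) (hmod : hasEntireLFunction_rat)
    (hMilneC : Milne1972.bsdQuotient_baseChange_quadratic_anyModel)
    (hr : W.analyticRank ≤ 1) (h2 : Module.finrank ℚ K = 2)
    (hWd : ∃ C : VariableChange ℚ, C • W.quadraticTwist (NumberField.discr K : ℚ) = Wd)
    (hrd : Wd.analyticRank ≤ 1) (hK : MissingPPartOverCAt (W.baseChange K) 2)
    (hu : MissingUpperBoundAt W 2) (hud : MissingUpperBoundAt Wd 2) : BSDp W 2 ∧ BSDp Wd 2 := by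
  haveI : Fact (Nat.Prime 2) := ⟨Nat.prime_two⟩
  haveI : (W.baseChange K).IsElliptic := by rw [baseChange]; infer_instance
  have hV : ∃ C : VariableChange K, C • W.baseChange K = W.baseChange K := ⟨1, one_smul _ _⟩
  obtain ⟨-, hfinW⟩ := hGZK W hr
  obtain ⟨-, hfinD⟩ := hGZK Wd hrd
  obtain ⟨hshaK, hWR⟩ := hMilneC W K h2 Wd hWd (W.baseChange K) hV hfinW hfinD
  obtain ⟨hW, hD⟩ := missingPPartAt_pair_of_overC_of_upper_upper W 2 K Wd (W.baseChange K) hmod h2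
    hWd hV hfinW hfinD hshaK hWR hK hu hud
  exact ⟨bsdp_of_missingPPartAt W 2 hGZK hr hW, bsdp_of_missingPPartAt Wd 2 hGZK hrd hD⟩

end Pair

/-! ## §2. An unramified quadratic twist stays in the defect-`≥ 3` sub-class -/

section Defect

/-- **Quadratic semistabilisability is invariant under quadratic twists** (one direction, which is
all that is used): if `C • W^{(n)} = Wd` with `n ≠ 0` and some twist of `Wd` is good or
multiplicative at `2`, then some twist of `W` is — `Wd^{(d')} = (C • W^{(n)})^{(d')} = C' • W^{(n d')}`
(`quadraticTwist_smul`, `quadraticTwist_quadraticTwist`) and the reduction type at `2` is an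
isomorphism invariant (`good_or_mult_two_smul_iff`). [cite: SilvermanAEC2009, X.5 Cor. 5.4.1] -/
theorem quadSemistabilisable_of_smul_quadraticTwist (W Wd : WeierstrassCurve ℚ) [W.IsElliptic]
    [Wd.IsElliptic] {n : ℚ} (hn : n ≠ 0) {C : VariableChange ℚ}
    (hC : C • W.quadraticTwist n = Wd) (h : QuadSemistabilisable Wd) : QuadSemistabilisable W := by
  obtain ⟨d', hd', hsemi⟩ := h
  haveI := W.isElliptic_quadraticTwist hn
  haveI := (W.quadraticTwist n).isElliptic_quadraticTwist hd'
  rw [← hC, quadraticTwist_smul, good_or_mult_two_smul_iff, quadraticTwist_quadraticTwist] at hsemi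
  exact ⟨n * d', mul_ne_zero hn hd', hsemi⟩

/-- **An unramified quadratic twist of a defect-`≥ 3` curve has defect `≥ 3`.** For elliptic
`W, Wd / ℚ`, `n ≡ 1 (mod 4)` and `C • W^{(n)} = Wd`: `DefectAtLeastThree W → DefectAtLeastThree Wd`
(additivity: lane A's `addv_two_of_smul_quadraticTwist_of_emod_four_eq_one`; non-semistabilisability:
`quadSemistabilisable_of_smul_quadraticTwist`). So the inert pair door needs the upper half ONLY on
the defect-`≥ 3` sub-class. [cite: SilvermanAEC2009, VII.5 Prop. 5.1, X.5 Cor. 5.4.1] -/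
theorem defectAtLeastThree_of_smul_quadraticTwist_of_emod_four_eq_one (W Wd : WeierstrassCurve ℚ)
    [W.IsElliptic] [Wd.IsElliptic] {n : ℤ} (hn4 : n % 4 = 1) {C : VariableChange ℚ}
    (hC : C • W.quadraticTwist (n : ℚ) = Wd) (hdef : DefectAtLeastThree W) :
    DefectAtLeastThree Wd := by
  have hn0 : ((n : ℤ) : ℚ) ≠ 0 := by exact_mod_cast (show n ≠ 0 by omega)
  exact ⟨addv_two_of_smul_quadraticTwist_of_emod_four_eq_one W Wd hn4 hC hdef.1,
    fun hq => hdef.2 (quadSemistabilisable_of_smul_quadraticTwist W Wd hn0 hC hq)⟩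

end Defect

/-! ## §3. The inert pair door on the canonical model -/

section Door

/-- **The defect-`≥ 3` sub-class through the INERT pair door on the CANONICAL model.** PRINT
{Gross–Zagier–Kolyvagin `hGZK`, modularity `hmod`, Milne 1972 any-model `hMilneC`, Murty–Murty 1997
`hMM` (twist supply with `2` inert)} + the UPPER half at the additive prime on the defect-`≥ 3`
sub-class only (`hU3`: `ord₂ #Ш ≤ ord₂ #Ш_an` — lens L1, Kato 14.5 (3) / 13.4 (3) print «p ≠ 2»;
DISPLAYED) + the `2`-part over the inert field on the canonical model (`hKC`: for every such `W` and
every quadratic `K` with `d_K ≡ 5 (mod 8)` and `L(W^{(d_K)}, 1) ≠ 0`,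
`MissingPPartOverCAt (W.baseChange K) 2` — BSD₂ over `K` for `E_K`, additive (potentially
supersingular) at the inert prime `(2)`, to be reached by the `Δ = C₃`-equivariant descent from a
cubic field of good reduction on the odd core; WALL on the 2-power core; DISPLAYED) ⟹ BSD₂ for every
non-CM analytic-rank-`0` `W` with `AddTwoL2.DefectAtLeastThree W` (1 382 book230 classes). Proof:
Murty–Murty's inert field `K`; a globally minimal model `Wd` of `W^{(d_K)}` is non-CM, analytic rank
`0` and again of defect `≥ 3` (§2), so `hU3` applies to `W` and `Wd`; §1 on `W.baseChange K`.
[cite: MurtyMurty1997, Ch. 6 Thm. 1.2 with the deduction of Thm. 1.1 (pp. 93–94, 96 of the text)]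
[cite: Milne1972ArithmeticAV, §1 Thm. 1 (through DokchitserDokchitserAnnals2010 §2.1)] -/
theorem additiveDefectAtTwo_of_upper_of_overKC_of_murtyMurty
    (hGZK : rank_eq_analyticRank_of_analyticRank_le_one) (hmod : hasEntireLFunction_rat)
    (hMilneC : Milne1972.bsdQuotient_baseChange_quadratic_anyModel)
    (hMM : murtyMurty_exists_twist_ne_zero_prescribedAtTwo)
    (hU3 : ∀ (W : WeierstrassCurve ℚ) [W.IsElliptic] [W.IsGloballyMinimal],
      ¬ W.HasCM → W.analyticRank = 0 → DefectAtLeastThree W → MissingUpperBoundAt W 2)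
    (hKC : ∀ (W : WeierstrassCurve ℚ) [W.IsElliptic] [W.IsGloballyMinimal],
      ¬ W.HasCM → W.analyticRank = 0 → DefectAtLeastThree W →
      ∀ (K : Type) [Field K] [NumberField K], Module.finrank ℚ K = 2 → TwoInert K →
        (W.quadraticTwist (NumberField.discr K : ℚ)).entireLFunction 1 ≠ 0 →
        MissingPPartOverCAt (W.baseChange K) 2)
    (W : WeierstrassCurve ℚ) [W.IsElliptic] [W.IsGloballyMinimal] (hcm : ¬ W.HasCM)
    (hr : W.analyticRank = 0) (hdef : DefectAtLeastThree W) : BSDp W 2 := by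
  haveI : Fact (Nat.Prime 2) := ⟨Nat.prime_two⟩
  obtain ⟨K, _, _, h2, hin, hL⟩ := existsNonvanishingInertTwist_of_murtyMurty hMM W
  have hd : (NumberField.discr K : ℚ) ≠ 0 := by exact_mod_cast NumberField.discr_ne_zero K
  haveI := W.isElliptic_quadraticTwist hd
  -- a globally minimal model `Wd` of the inert twist
  obtain ⟨C, hCmin⟩ := hasGlobalMinimalModel_rat_holds (W.quadraticTwist (NumberField.discr K : ℚ))
  haveI : (C • W.quadraticTwist (NumberField.discr K : ℚ)).IsGloballyMinimal := hCmin
  set Wd := C • W.quadraticTwist (NumberField.discr K : ℚ) with hWd_def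
  have hWd : ∃ C' : VariableChange ℚ, C' • W.quadraticTwist (NumberField.discr K : ℚ) = Wd := ⟨C, rfl⟩
  have hcmd : ¬ Wd.HasCM := by
    intro h
    apply hcm
    have h1 : (W.quadraticTwist (NumberField.discr K : ℚ)).HasCM :=
      (hasCM_iff_of_j_eq ((W.quadraticTwist (NumberField.discr K : ℚ)).variableChange_j C)).mp h
    exact (hasCM_iff_of_j_eq (W.j_quadraticTwist hd)).mp h1
  have hrd : Wd.analyticRank = 0 := by
    rw [hWd_def, analyticRank_smul]
    exact analyticRank_eq_zero_of_entireLFunction_one_ne_zero hL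
  have hin4 : NumberField.discr K % 4 = 1 := by
    have h5 : NumberField.discr K % 8 = 5 := hin
    omega
  have hdefd : DefectAtLeastThree Wd :=
    defectAtLeastThree_of_smul_quadraticTwist_of_emod_four_eq_one W Wd hin4 rfl hdef
  exact (bsdp_two_pair_of_overKC_of_upper_upper W K Wd hGZK hmod hMilneC (by omega) h2 hWd (by omega)
    (hKC W hcm hr hdef K h2 hin hL) (hU3 W hcm hr hdef) (hU3 Wd hcmd hrd hdefd)).1

end Door

/-! ## §4. Exactness certificates -/

section Exact

/-- **EXACTNESS on the defect-`≥ 3` sub-class.** Granted PRINT {`hGZK`, `hmod`, `hMilneC`, `hMM`},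
BSD₂ ∀-closed on the defect-`≥ 3` sub-class is EQUIVALENT to the conjunction of the two displayed
∀-objects of the canonical inert door: the upper half on the sub-class (`hU3`) AND the `2`-part over
every admissible inert quadratic field on the canonical model (`hKC`). (`←`: the door; `→`: BSD₂
gives the upper half — `missingPPartAt_of_bsdp` — and, applied to `W` and to a minimal model of the
inert twist (again in the sub-class, §2), gives the over-`K` statement by
`AdditivePotMult.missingPPartOverCAt_baseChange_iff_bsdp`.) Honest label: a certified RESHAPE of the
wall `stub_addDefectThree` into two objects each strictly weaker than the wall and jointly equal to it;
neither is in print at `p = 2`.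
[cite: MurtyMurty1997, Ch. 6 Thm. 1.2 with the deduction of Thm. 1.1 (pp. 93–94, 96 of the text)]
[cite: Milne1972ArithmeticAV, §1 Thm. 1 (through DokchitserDokchitserAnnals2010 §2.1)] -/
theorem additiveDefectAtTwo_iff_upper_and_overKC_of_murtyMurty
    (hGZK : rank_eq_analyticRank_of_analyticRank_le_one) (hmod : hasEntireLFunction_rat)
    (hMilneC : Milne1972.bsdQuotient_baseChange_quadratic_anyModel)
    (hMM : murtyMurty_exists_twist_ne_zero_prescribedAtTwo) :
    (∀ (W : WeierstrassCurve ℚ) [W.IsElliptic] [W.IsGloballyMinimal],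
      ¬ W.HasCM → W.analyticRank = 0 → DefectAtLeastThree W → BSDp W 2) ↔
    ((∀ (W : WeierstrassCurve ℚ) [W.IsElliptic] [W.IsGloballyMinimal],
        ¬ W.HasCM → W.analyticRank = 0 → DefectAtLeastThree W → MissingUpperBoundAt W 2) ∧
      (∀ (W : WeierstrassCurve ℚ) [W.IsElliptic] [W.IsGloballyMinimal],
        ¬ W.HasCM → W.analyticRank = 0 → DefectAtLeastThree W →
        ∀ (K : Type) [Field K] [NumberField K], Module.finrank ℚ K = 2 → TwoInert K →
          (W.quadraticTwist (NumberField.discr K : ℚ)).entireLFunction 1 ≠ 0 →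
          MissingPPartOverCAt (W.baseChange K) 2)) := by
  haveI : Fact (Nat.Prime 2) := ⟨Nat.prime_two⟩
  constructor
  · intro hB
    refine ⟨fun W _ _ hcm hr hdef => ?_, fun W _ _ hcm hr hdef K _ _ h2 hin hL => ?_⟩
    · -- BSD₂ ⇒ upper half
      obtain ⟨-, hfin⟩ := hGZK W (by rw [hr]; exact zero_le_one)
      haveI : Finite W.sha := hfin
      exact (lower_and_upper_of_missingPPartAt W 2 (missingPPartAt_of_bsdp W 2 (hB W hcm hr hdef))).2
    · -- BSD₂ for `W` and for the inert twist ⇒ the `2`-part over `K` on the canonical model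
      have hd : (NumberField.discr K : ℚ) ≠ 0 := by exact_mod_cast NumberField.discr_ne_zero K
      haveI := W.isElliptic_quadraticTwist hd
      obtain ⟨C, hCmin⟩ :=
        hasGlobalMinimalModel_rat_holds (W.quadraticTwist (NumberField.discr K : ℚ))
      haveI : (C • W.quadraticTwist (NumberField.discr K : ℚ)).IsGloballyMinimal := hCmin
      set Wd := C • W.quadraticTwist (NumberField.discr K : ℚ) with hWd_def
      have hWd : ∃ C' : VariableChange ℚ, C' • W.quadraticTwist (NumberField.discr K : ℚ) = Wd :=
        ⟨C, rfl⟩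
      have hcmd : ¬ Wd.HasCM := by
        intro h
        apply hcm
        have h1 : (W.quadraticTwist (NumberField.discr K : ℚ)).HasCM :=
          (hasCM_iff_of_j_eq ((W.quadraticTwist (NumberField.discr K : ℚ)).variableChange_j C)).mp h
        exact (hasCM_iff_of_j_eq (W.j_quadraticTwist hd)).mp h1
      have hrd : Wd.analyticRank = 0 := by
        rw [hWd_def, analyticRank_smul]
        exact analyticRank_eq_zero_of_entireLFunction_one_ne_zero hL
      have hin4 : NumberField.discr K % 4 = 1 := by
        have h5 : NumberField.discr K % 8 = 5 := hin
        omega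
      have hdefd : DefectAtLeastThree Wd :=
        defectAtLeastThree_of_smul_quadraticTwist_of_emod_four_eq_one W Wd hin4 rfl hdef
      have hBd : BSDp Wd 2 := hB Wd hcmd hrd hdefd
      exact (missingPPartOverCAt_baseChange_iff_bsdp W 2 K Wd hGZK hmod hMilneC (by omega) h2 hWd
        (by omega) hBd).mpr (hB W hcm hr hdef)
  · rintro ⟨hU3, hKC⟩ W _ _ hcm hr hdef
    exact additiveDefectAtTwo_of_upper_of_overKC_of_murtyMurty hGZK hmod hMilneC hMM hU3 hKC W hcm
      hr hdef

/-- **EXACTNESS at crux level.** Granted PRINT {`hGZK`, `hmod`, `hMilneC`, `hMM`}, the crux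
`AdditiveRankZeroAtTwo` is EQUIVALENT to the conjunction of (i) its quadratic part (BSD₂ ∀-closed on
the quadratically semistabilisable sub-class — line `add_twist_overK`'s three non-wall stubs, lane
A's exactness `Theorems.forall_overKC_iff_additiveQuadraticAtTwo` relocates it further), (ii) the
upper half on the defect-`≥ 3` sub-class (`hU3`) and (iii) the `2`-part over admissible inert
quadratic fields on the canonical model (`hKC`) — by the exact sub-partition glue
`Theorems.additiveRankZeroAtTwo_iff_quadratic_and_defect` and the previous theorem. This is the
honest ∀-level shape of item 19098 after the twist supplies (Hoffstein–Luo, Murty–Murty) are PRINT: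
three research objects, no hidden loss.
[cite: MurtyMurty1997, Ch. 6 Thm. 1.2 with the deduction of Thm. 1.1 (pp. 93–94, 96 of the text)]
[cite: Milne1972ArithmeticAV, §1 Thm. 1 (through DokchitserDokchitserAnnals2010 §2.1)] -/
theorem additiveRankZeroAtTwo_iff_quadratic_and_upper_and_overKC_of_murtyMurty
    (hGZK : rank_eq_analyticRank_of_analyticRank_le_one) (hmod : hasEntireLFunction_rat)
    (hMilneC : Milne1972.bsdQuotient_baseChange_quadratic_anyModel)
    (hMM : murtyMurty_exists_twist_ne_zero_prescribedAtTwo) :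
    Summit.BirchSwinnertonDyer.BirchSwinnertonDyer.Theses.ByReductionTypeAtTwo.AdditiveRankZeroAtTwo ↔
    ((∀ (W : WeierstrassCurve ℚ) [W.IsElliptic] [W.IsGloballyMinimal],
        ¬ W.HasCM → W.analyticRank = 0 → Addv W 2 → QuadSemistabilisable W → BSDp W 2) ∧
      (∀ (W : WeierstrassCurve ℚ) [W.IsElliptic] [W.IsGloballyMinimal],
        ¬ W.HasCM → W.analyticRank = 0 → DefectAtLeastThree W → MissingUpperBoundAt W 2) ∧
      (∀ (W : WeierstrassCurve ℚ) [W.IsElliptic] [W.IsGloballyMinimal],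
        ¬ W.HasCM → W.analyticRank = 0 → DefectAtLeastThree W →
        ∀ (K : Type) [Field K] [NumberField K], Module.finrank ℚ K = 2 → TwoInert K →
          (W.quadraticTwist (NumberField.discr K : ℚ)).entireLFunction 1 ≠ 0 →
          MissingPPartOverCAt (W.baseChange K) 2)) := by
  rw [additiveRankZeroAtTwo_iff_quadratic_and_defect,
    additiveDefectAtTwo_iff_upper_and_overKC_of_murtyMurty hGZK hmod hMilneC hMM]

/-- **The crux BY NAME from the three research objects and PRINT** (the `←` direction of the
previous certificate, spelled out for consumers): quadratic part `hQ` + upper half on the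
defect-`≥ 3` sub-class `hU3` + `2`-part over admissible inert quadratic fields on the canonical model
`hKC` + PRINT {`hGZK`, `hmod`, `hMilneC`, `hMM`} ⟹ `AdditiveRankZeroAtTwo`. Honest label: `hQ`, `hU3`,
`hKC` are DISPLAYED research objects (none in print at `p = 2`); this theorem credits nothing.
[cite: MurtyMurty1997, Ch. 6 Thm. 1.2 with the deduction of Thm. 1.1 (pp. 93–94, 96 of the text)]
[cite: Milne1972ArithmeticAV, §1 Thm. 1 (through DokchitserDokchitserAnnals2010 §2.1)] -/
theorem additiveRankZeroAtTwo_of_quadratic_of_upper_of_overKC_of_murtyMurty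
    (hGZK : rank_eq_analyticRank_of_analyticRank_le_one) (hmod : hasEntireLFunction_rat)
    (hMilneC : Milne1972.bsdQuotient_baseChange_quadratic_anyModel)
    (hMM : murtyMurty_exists_twist_ne_zero_prescribedAtTwo)
    (hQ : ∀ (W : WeierstrassCurve ℚ) [W.IsElliptic] [W.IsGloballyMinimal],
      ¬ W.HasCM → W.analyticRank = 0 → Addv W 2 → QuadSemistabilisable W → BSDp W 2)
    (hU3 : ∀ (W : WeierstrassCurve ℚ) [W.IsElliptic] [W.IsGloballyMinimal],
      ¬ W.HasCM → W.analyticRank = 0 → DefectAtLeastThree W → MissingUpperBoundAt W 2)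
    (hKC : ∀ (W : WeierstrassCurve ℚ) [W.IsElliptic] [W.IsGloballyMinimal],
      ¬ W.HasCM → W.analyticRank = 0 → DefectAtLeastThree W →
      ∀ (K : Type) [Field K] [NumberField K], Module.finrank ℚ K = 2 → TwoInert K →
        (W.quadraticTwist (NumberField.discr K : ℚ)).entireLFunction 1 ≠ 0 →
        MissingPPartOverCAt (W.baseChange K) 2) :
    Summit.BirchSwinnertonDyer.BirchSwinnertonDyer.Theses.ByReductionTypeAtTwo.AdditiveRankZeroAtTwo :=
  (additiveRankZeroAtTwo_iff_quadratic_and_upper_and_overKC_of_murtyMurty hGZK hmod hMilneC hMM).mpr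
    ⟨hQ, hU3, hKC⟩

end Exact

end Summit.BirchSwinnertonDyer.BirchSwinnertonDyer.Theorems

end
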